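import Mathlib.Analysis.SpecificLimits.Basic
import Summits.Ventures.CertifiedArithmetic.LowPrec.GemmThetaLawMixBFamily
import Summits.Ventures.CertifiedArithmetic.LowPrec.GemmThetaLawGenBinary32
import Summits.Ventures.CertifiedArithmetic.LowPrec.GemmWorstCaseE2M1
import HarnessLib

/-!
# GEMM worst case LVI — `W_p(n)` for E3M2·E2M1 (FP6·FP4) into EVERY precision `p ≥ 13`: the
# two-sided sandwich `θ_p/(n - 1 + θ_p(25/2 + κ_p)) ≤ 1 - W_p(n) ≤ θ_p/(n - c_p)` and the
# limit `n(1 - W_p(n)) → θ_p`, kernel-checked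

HONEST FRAMING: certified error envelopes and provably optimal rounding/accumulation schemes for
low-precision formats under stated cost models; every table by two implementations; no hardware or
vendor claims.

`W_φ(n)` (`worstRelErrMixB φ (n-1)`) is the largest relative error `|ŝ - s|/Σ|x_i|` of
sequential round-to-nearest-even accumulation in the format `φ` over ALL words of `n` letters
from the 143-letter mixed product alphabet `Λ(E3M2·E2M1)/2^5` of the generated law
`e3m2e2m1Law` (`GemmThetaLawGenMixBData`; every product of an E3M2 and an E2M1 datum is such a
letter, `mul_mem_PiL_e3m2e2m1` of `GemmThetaLawGenBinary32`) — a finite maximum.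
For every format `φ` with `12 ≤ manBits φ` (`p ≥ 13`), `qexp φ ≤ -5` and
`2^(manBits φ + 15) ≤ maxRat φ` (binary32, binary64, …), with the law's constants
`θ_p = e3m2e2m1Law.thetaL (manBits φ) = (65·2^manBits + 128)/512`,
`κ_p = 2048/(260·2^manBits + 512) = 1/θ_p` (`e3m2e2m1Law_constants`) and `K = 2^(p-11)`
(`2^manBits = 1024K`, `θ_p = (1040K + 2)/8`):

* `worst5P_le` (SUP side, every `n`): `W_φ(n) ≤ 1 - θ_p/(n - 1 + θ_p(1 + 23/2 + κ_p))` —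
  the generated law certificate `thetaCert_e3m2e2m1Law` (`GemmThetaLawGenFinal`) through
  `ThetaCertificate.abs_err_le` (`ρ = 7/2 ≤ β_pair = 23/2`);
* `one_sub_worst5P_le` (the family of file LV, every `n ≥ 10753K + 2`, every `p ≥ 11`):
  `1 - W_φ(n) ≤ (1040K + 2)/(8n - 77312K + 1) = θ_p/(n - c_p)`, `c_p = (77312K - 1)/8`;
* `worst5P_sandwich`: both at once — the E3M2·E2M1 row of gemm.tex Thm. `t:thetapmix` for
  every `p ≥ 13`, with onset `m_p = 10753K + 2 = 21·2^(p-2) + 2 + 2^(p-11)`;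
* `worst5P_tendsto`: `n·(1 - W_φ(n)) → θ_p` (in `ℝ`, by the sandwich);
* `worst5P_sandwich_Binary32`: the instance `p = 24` (`K = 8192`) in integers —
  `8519682/(8n + 106496025) ≤ 1 - W_24(n) ≤ 8519682/(8n - 633339903)` for every
  `n ≥ 88088578` (the left side agrees with `abs_dot_err_le_e3m2e2m1_Binary32`; the common
  numerator is `8θ_24`, `θ_24 = 4259841/4`, because `κ_p θ_p = 1`).

What is NOT claimed: the exact value of `W_p(n)` between the two sides; `p ∈ {11, 12}` (the
family of file LV is valid there, but the law certificate needs `p ≥ 13`); bfloat16 (`p = 8`,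
settled for every `n` in `GemmThetaLawMix`).  References: [Higham2002, §4.2],
[MullerEtAl2018HFPA, §6.1], [BoldoMelquiond2011Flocq]; [RouhaniEtAl2023MX, Table 1].
-/

namespace Summit.Ventures.CertifiedArithmetic.LowPrec.Gemm

open Literature.ComputerArithmetic.FloatingPoint
open Literature.ComputerArithmetic.FloatingPoint.MiniFloat
open Literature.ComputerArithmetic.FloatingPoint.MiniFloat.ThetaLaw
open Finset

/-! ### `W_φ(n)` over the mixed alphabet, any target format -/

/-- The law's alphabet `Λ(E3M2·E2M1)` has `143 = 1 + 2·71` grid integers. [cell, kernel] -/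
theorem lamMixB_length : e3m2e2m1Law.lam.length = 143 := by decide +kernel

/-- THE INPUT SPELLED BY A WORD `w : Fin (m+1) → Fin 143` (letters `Λ/2^5` by index; `0` after
position `m`). [cell, gemm.tex §Model] -/
def wordInputMixB {m : ℕ} (w : Fin (m + 1) → Fin 143) : ℕ → ℚ :=
  fun j => if h : j < m + 1 then
      ((e3m2e2m1Law.lam[(w ⟨j, h⟩).val]'(by rw [lamMixB_length]; exact (w _).isLt) : ℤ) : ℚ)
        / 2 ^ 5
    else 0

/-- Every term of a word input is a letter of the law. [cell] -/
theorem wordInputMixB_mem {m : ℕ} (w : Fin (m + 1) → Fin 143) (j : ℕ) :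
    e3m2e2m1Law.PiL 5 (wordInputMixB w j) := by
  unfold wordInputMixB
  split_ifs
  · exact ⟨_, List.getElem_mem _, rfl⟩
  · exact ⟨0, by decide, by norm_num⟩

/-- `W_φ(n)` for `n = m + 1`: the largest relative error of sequential RNE accumulation in `φ`
over all words of `n` letters from `Λ(E3M2·E2M1)/2^5`. [cell, gemm.tex §Regimes] -/
def worstRelErrMixB (φ : Format) (m : ℕ) : ℚ :=
  (univ : Finset (Fin (m + 1) → Fin 143)).sup' univ_nonempty
    (fun w => relErr φ (wordInputMixB w) m)

/-- Every input over the alphabet is dominated by `W_φ`. [folklore] -/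
theorem relErr_le_worst5P (φ : Format) (x : ℕ → ℚ) (hx : ∀ j, e3m2e2m1Law.PiL 5 (x j))
    (m : ℕ) : relErr φ x m ≤ worstRelErrMixB φ m := by
  classical
  have hidx : ∀ j, ∃ i : Fin 143, ∀ h : i.val < e3m2e2m1Law.lam.length,
      ((e3m2e2m1Law.lam[i.val]'h : ℤ) : ℚ) / 2 ^ 5 = x j := by
    intro j
    obtain ⟨z, hz, hxz⟩ := hx j
    obtain ⟨i, hi, h⟩ := List.getElem_of_mem hz
    exact ⟨⟨i, by simpa [lamMixB_length] using hi⟩, fun _ => by rw [hxz, ← h]⟩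
  choose f hf using hidx
  have hxy : ∀ j ≤ m, x j = wordInputMixB (fun j : Fin (m + 1) => f j.val) j := by
    intro j hj
    unfold wordInputMixB
    rw [dif_pos (by omega)]
    exact (hf j _).symm
  rw [relErr_congr φ hxy]
  exact le_sup' (fun w => relErr φ (wordInputMixB w) m) (mem_univ _)

/-! ### The law's constants for every precision -/

/-- THE CONSTANTS OF THE E3M2·E2M1 LAW AT EVERY `m = manBits`: `θ = (65·2^m + 128)/512`,
`κ = 2048/(260·2^m + 512)`, `ρ = 7/2`, `β_pair = 23/2`. [cell, gemm.tex Thm. t:thetapmix] -/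
theorem e3m2e2m1Law_constants (mb : ℕ) :
    e3m2e2m1Law.thetaL mb = (65 * 2 ^ mb + 128) / 512 ∧
    e3m2e2m1Law.kappaL mb = 2048 / (260 * 2 ^ mb + 512) ∧
    e3m2e2m1Law.rhoL = 7 / 2 ∧ e3m2e2m1Law.betaL = 23 / 2 := by
  have hB : e3m2e2m1Law.Bj 11 = 260 := by decide
  have hS : e3m2e2m1Law.Sj 11 = 512 := by decide
  simp only [LawData.thetaL, LawData.kappaL, LawData.rhoL, LawData.betaL,
    show e3m2e2m1Law.kb = 11 from rfl, hB, hS, show e3m2e2m1Law.th1 = 65 from rfl,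
    show e3m2e2m1Law.th0 = 128 from rfl, show e3m2e2m1Law.thD = 512 from rfl,
    show e3m2e2m1Law.rhoN = 7 from rfl, show e3m2e2m1Law.rhoD = 2 from rfl,
    show e3m2e2m1Law.betaN = 23 from rfl, show e3m2e2m1Law.betaD = 2 from rfl]
  norm_num

/-- With `K = 2^(p-11)` (`2^manBits = 1024K`): `θ_p = (1040K + 2)/8`. [gemm.tex Thm. t:thetapmix] -/
theorem thetaL5_eq {φ : Format} {K : ℕ} (hM : 2 ^ φ.manBits = 1024 * K) :
    e3m2e2m1Law.thetaL φ.manBits = (1040 * (K : ℚ) + 2) / 8 := by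
  have hM' : ((2 ^ φ.manBits : ℕ) : ℚ) = ((1024 * K : ℕ) : ℚ) := by rw [hM]
  push_cast at hM'
  rw [(e3m2e2m1Law_constants φ.manBits).1, hM', div_eq_div_iff (by norm_num) (by norm_num)]
  ring

/-- `θ_p > 0`. [cell] -/
theorem thetaL5_pos (mb : ℕ) : 0 < e3m2e2m1Law.thetaL mb := by
  rw [(e3m2e2m1Law_constants mb).1]; positivity

/-- `κ_p ≥ 0`. [cell] -/
theorem kappaL5_nonneg (mb : ℕ) : 0 ≤ e3m2e2m1Law.kappaL mb := by
  rw [(e3m2e2m1Law_constants mb).2.1]; positivity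

/-! ### The sandwich -/

/-- SUP SIDE FOR EVERY `p ≥ 13` AND EVERY `n = m + 1` (kernel: the generated law certificate
`thetaCert_e3m2e2m1Law`): `W_φ(n) ≤ 1 - θ_p/(m + θ_p(1 + 23/2 + κ_p))`.
[cell, gemm.tex Thm. t:thetapmix] -/
theorem worst5P_le (φ : Format) (hm : 12 ≤ φ.manBits) (hq : φ.qexp ≤ -5)
    (hR : (2 : ℚ) ^ (φ.manBits + 15) ≤ φ.maxRat) (m : ℕ) :
    worstRelErrMixB φ m ≤ 1 - e3m2e2m1Law.thetaL φ.manBits /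
      ((m : ℚ) + e3m2e2m1Law.thetaL φ.manBits * (1 + (23 / 2 + e3m2e2m1Law.kappaL φ.manBits))) := by
  have hθ := thetaL5_pos φ.manBits
  have hκ := kappaL5_nonneg φ.manBits
  apply sup'_le
  intro w _
  unfold relErr
  have hc : (0 : ℚ) ≤ 1 - e3m2e2m1Law.thetaL φ.manBits /
      ((m : ℚ) + e3m2e2m1Law.thetaL φ.manBits * (1 + (23 / 2 + e3m2e2m1Law.kappaL φ.manBits))) := by
    rw [sub_nonneg, div_le_one (by positivity)]
    nlinarith [show (0 : ℚ) ≤ m from Nat.cast_nonneg m]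
  by_cases hL : ∑ j ∈ range (m + 1), |wordInputMixB w j| = 0
  · rw [hL, div_zero]; exact hc
  · have hpos : 0 < ∑ j ∈ range (m + 1), |wordInputMixB w j| :=
      lt_of_le_of_ne (sum_nonneg fun i _ => abs_nonneg _) (Ne.symm hL)
    rw [div_le_iff₀ hpos]
    have h := (thetaCert_e3m2e2m1Law φ hm hq hR).abs_err_le (fun q hq' => PiL_neg _ _ hq') _
      (fun j => wordInputMixB_mem w j) m
    rw [(e3m2e2m1Law_constants φ.manBits).2.2.1, (e3m2e2m1Law_constants φ.manBits).2.2.2,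
      max_eq_right (by norm_num : (7 / 2 : ℚ) ≤ 23 / 2)] at h
    exact h

/-- THE FAMILY SIDE FOR EVERY `n = m + 1 ≥ 10753K + 2` (file LV, `K = 2^(p-11)`, every
`p ≥ 11`): `1 - W_φ(n) ≤ (1040K + 2)/(8n - 77312K + 1) = θ_p/(n - c_p)`.
[cell, gemm.tex Thm. t:thetapmix] -/
theorem one_sub_worst5P_le (φ : Format) (hq : φ.qexp ≤ -5)
    (hR : (2 : ℚ) ^ (φ.manBits + 15) ≤ φ.maxRat) {K : ℕ} (hM : 2 ^ φ.manBits = 1024 * K)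
    (m : ℕ) (hmK : 10753 * K + 1 ≤ m) :
    1 - worstRelErrMixB φ m
      ≤ (1040 * (K : ℚ) + 2) / (8 * ((m : ℚ) + 1) - 77312 * K + 1) := by
  have hw := relErr_le_worst5P φ (fam5 K) (fam5_mem K) m
  have hd := fam5_defect hq hR hM m hmK
  unfold relErr at hw
  linarith

/-- THE TWO-SIDED SANDWICH FOR EVERY PRECISION `p ≥ 13` AND EVERY `n ≥ 10753·2^(p-11) + 2`
(`n = m + 1`, `K = 2^(p-11)`, `θ_p = (1040K + 2)/8`, `κ_p = 2048/(260·2^manBits + 512)`):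
`θ_p/(m + θ_p(1 + 23/2 + κ_p)) ≤ 1 - W_p(n) ≤ θ_p/(n - (77312K - 1)/8)`, both sides
kernel-checked. [cell, gemm.tex Thm. t:thetapmix] -/
theorem worst5P_sandwich (φ : Format) (hm : 12 ≤ φ.manBits) (hq : φ.qexp ≤ -5)
    (hR : (2 : ℚ) ^ (φ.manBits + 15) ≤ φ.maxRat) {K : ℕ} (hM : 2 ^ φ.manBits = 1024 * K)
    (m : ℕ) (hmK : 10753 * K + 1 ≤ m) :
    e3m2e2m1Law.thetaL φ.manBits /
        ((m : ℚ) + e3m2e2m1Law.thetaL φ.manBits * (1 + (23 / 2 + e3m2e2m1Law.kappaL φ.manBits)))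
        ≤ 1 - worstRelErrMixB φ m ∧
      1 - worstRelErrMixB φ m
        ≤ e3m2e2m1Law.thetaL φ.manBits / ((m + 1 : ℚ) - (77312 * K - 1) / 8) := by
  refine ⟨by linarith [worst5P_le φ hm hq hR m], ?_⟩
  have h := one_sub_worst5P_le φ hq hR hM m hmK
  have eB : (m + 1 : ℚ) - (77312 * K - 1) / 8
      = (8 * ((m : ℚ) + 1) - 77312 * K + 1) / 8 := by
    ring
  rw [thetaL5_eq hM, eB, div_div_div_cancel_right₀ (by norm_num : (8 : ℚ) ≠ 0)]
  exact h

/-- THE LIMIT, EVERY PRECISION `p ≥ 13`: `n · (1 - W_p(n)) → θ_p` as `n → ∞` (squeezed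
between the two sides of `worst5P_sandwich`). [cell, gemm.tex Thm. t:thetapmix] -/
theorem worst5P_tendsto (φ : Format) (hm : 12 ≤ φ.manBits) (hq : φ.qexp ≤ -5)
    (hR : (2 : ℚ) ^ (φ.manBits + 15) ≤ φ.maxRat) :
    Filter.Tendsto (fun m : ℕ => ((m : ℝ) + 1) * (1 - (worstRelErrMixB φ m : ℝ)))
      Filter.atTop (nhds (e3m2e2m1Law.thetaL φ.manBits : ℝ)) := by
  obtain ⟨K, hM⟩ : ∃ K, 2 ^ φ.manBits = 1024 * K :=
    ⟨2 ^ (φ.manBits - 10), by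
      rw [show (1024 : ℕ) = 2 ^ 10 by norm_num, ← pow_add, Nat.add_sub_cancel' (by omega)]⟩
  set θ : ℝ := (e3m2e2m1Law.thetaL φ.manBits : ℝ) with hθdef
  set a : ℝ := θ * (1 + (23 / 2 + (e3m2e2m1Law.kappaL φ.manBits : ℝ))) - 1 with hadef
  set b : ℝ := (77312 * (K : ℝ) - 1) / 8 with hbdef
  have hlim0 : Filter.Tendsto (fun m : ℕ => 1 / ((m : ℝ) + 1)) Filter.atTop (nhds 0) :=
    tendsto_one_div_add_atTop_nhds_zero_nat
  have hg : Filter.Tendsto (fun m : ℕ => θ / (1 + a * (1 / ((m : ℝ) + 1)))) Filter.atTop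
      (nhds θ) := by
    have h : Filter.Tendsto (fun m : ℕ => θ / (1 + a * (1 / ((m : ℝ) + 1)))) Filter.atTop
        (nhds (θ / (1 + a * 0))) :=
      tendsto_const_nhds.div (tendsto_const_nhds.add (tendsto_const_nhds.mul hlim0))
        (by norm_num)
    rw [mul_zero, add_zero, div_one] at h
    exact h
  have hh : Filter.Tendsto (fun m : ℕ => θ / (1 - b * (1 / ((m : ℝ) + 1)))) Filter.atTop
      (nhds θ) := by
    have h : Filter.Tendsto (fun m : ℕ => θ / (1 - b * (1 / ((m : ℝ) + 1)))) Filter.atTop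
        (nhds (θ / (1 - b * 0))) :=
      tendsto_const_nhds.div (tendsto_const_nhds.sub (tendsto_const_nhds.mul hlim0))
        (by norm_num)
    rw [mul_zero, sub_zero, div_one] at h
    exact h
  refine tendsto_of_tendsto_of_tendsto_of_le_of_le' hg hh ?_ ?_
  · refine Filter.eventually_atTop.2 ⟨10753 * K + 1, fun m hmK => ?_⟩
    have hr1 := (Rat.cast_le (K := ℝ)).mpr (worst5P_sandwich φ hm hq hR hM m hmK).1
    push_cast at hr1
    have hm0 : (0 : ℝ) < (m : ℝ) + 1 := by positivity
    have hm1 : (m : ℝ) + 1 ≠ 0 := hm0.ne'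
    have e1 : 1 + a * (1 / ((m : ℝ) + 1)) = (((m : ℝ) + 1) + a) / ((m : ℝ) + 1) := by
      rw [eq_div_iff hm1, add_mul, one_mul, mul_assoc, one_div_mul_cancel hm1, mul_one]
    have e2 : ((m : ℝ) + 1) + a
        = (m : ℝ) + θ * (1 + (23 / 2 + (e3m2e2m1Law.kappaL φ.manBits : ℝ))) := by
      rw [hadef]; ring
    show θ / (1 + a * (1 / ((m : ℝ) + 1))) ≤ ((m : ℝ) + 1) * (1 - (worstRelErrMixB φ m : ℝ))
    rw [e1, div_div_eq_mul_div, e2]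
    calc θ * ((m : ℝ) + 1) / ((m : ℝ) + θ * (1 + (23 / 2 + (e3m2e2m1Law.kappaL φ.manBits : ℝ))))
        = ((m : ℝ) + 1) *
            (θ / ((m : ℝ) + θ * (1 + (23 / 2 + (e3m2e2m1Law.kappaL φ.manBits : ℝ))))) := by ring
      _ ≤ ((m : ℝ) + 1) * (1 - (worstRelErrMixB φ m : ℝ)) :=
          mul_le_mul_of_nonneg_left hr1 hm0.le
  · refine Filter.eventually_atTop.2 ⟨10753 * K + 1, fun m hmK => ?_⟩
    have hr2 := (Rat.cast_le (K := ℝ)).mpr (worst5P_sandwich φ hm hq hR hM m hmK).2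
    push_cast at hr2
    have hm0 : (0 : ℝ) < (m : ℝ) + 1 := by positivity
    have hm1 : (m : ℝ) + 1 ≠ 0 := hm0.ne'
    have e1 : 1 - b * (1 / ((m : ℝ) + 1)) = (((m : ℝ) + 1) - b) / ((m : ℝ) + 1) := by
      rw [eq_div_iff hm1, sub_mul, one_mul, mul_assoc, one_div_mul_cancel hm1, mul_one]
    show ((m : ℝ) + 1) * (1 - (worstRelErrMixB φ m : ℝ))
      ≤ θ / (1 - b * (1 / ((m : ℝ) + 1)))
    rw [e1, div_div_eq_mul_div, hbdef]
    calc ((m : ℝ) + 1) * (1 - (worstRelErrMixB φ m : ℝ))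
        ≤ ((m : ℝ) + 1) * (θ / (((m : ℝ) + 1) - (77312 * (K : ℝ) - 1) / 8)) :=
          mul_le_mul_of_nonneg_left hr2 hm0.le
      _ = θ * ((m : ℝ) + 1) / (((m : ℝ) + 1) - (77312 * (K : ℝ) - 1) / 8) := by ring

/-! ### The instance `p = 24` (binary32) in integers -/

/-- binary32 meets the hypotheses, with `K = 2^13 = 8192`. [cite: IEEE7542019, Table 3.5] -/
theorem Binary32_hyps5 : 12 ≤ Format.Binary32.manBits ∧ Format.Binary32.qexp ≤ -5 ∧
    (2 : ℚ) ^ (Format.Binary32.manBits + 15) ≤ Format.Binary32.maxRat ∧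
    2 ^ Format.Binary32.manBits = 1024 * 8192 := by
  obtain ⟨h1, h2, h3⟩ := Binary32_gen_hyps
  exact ⟨by rw [h1]; norm_num, h2, h3, by rw [h1]; norm_num⟩

/-- E3M2·E2M1 INTO binary32, EVERY `n ≥ 88088578 = 10753·2^13 + 2`:
`8519682/(8n + 106496025) ≤ 1 - W_24(n) ≤ 8519682/(8n - 633339903)` (`8519682 = 8θ_24`);
the left side holds for every `n` (the law's envelope `abs_dot_err_le_e3m2e2m1_Binary32`), the
right side is the family; `θ_24 = 4259841/4` and `n(1 - W_24(n)) → θ_24`.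
[cell, gemm.tex Thm. t:thetapmix at p = 24] -/
theorem worst5P_sandwich_Binary32 (m : ℕ) (hm : 88088577 ≤ m) :
    8519682 / (8 * ((m : ℚ) + 1) + 106496025)
        ≤ 1 - worstRelErrMixB Format.Binary32 m ∧
      1 - worstRelErrMixB Format.Binary32 m ≤ 8519682 / (8 * ((m : ℚ) + 1) - 633339903) := by
  obtain ⟨h1, h2, h3, h4⟩ := Binary32_hyps5
  have h := worst5P_sandwich Format.Binary32 h1 h2 h3 h4 m (by omega)
  rw [Binary32_gen_hyps.1, lawConstants_Binary32.2.2.2.2.2.2.2.2.1,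
    lawConstants_Binary32.2.2.2.2.2.2.2.2.2.1] at h
  have hm' : (88088577 : ℚ) ≤ m := by exact_mod_cast hm
  have e1 : (4259841 / 4 : ℚ) / ((m : ℚ) + 4259841 / 4 * (1 + (23 / 2 + 4 / 4259841)))
      = 8519682 / (8 * ((m : ℚ) + 1) + 106496025) := by
    rw [div_eq_div_iff (by positivity) (by positivity)]; ring
  have e2 : (4259841 / 4 : ℚ) / ((m + 1 : ℚ) - (77312 * ((8192 : ℕ) : ℚ) - 1) / 8)
      = 8519682 / (8 * ((m : ℚ) + 1) - 633339903) := by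
    rw [div_eq_div_iff (ne_of_gt (by push_cast; linarith)) (ne_of_gt (by linarith))]
    push_cast; ring
  rw [e1, e2] at h
  exact h

end Summit.Ventures.CertifiedArithmetic.LowPrec.Gemm
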